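import Mathlib
import Literature.MathematicalPhysics.KineticTheory.FluctuationAbelPositivity
import HarnessLib

/-!
# `EmbeddedDrudeMourre.MourreDissolution`, line `separable-vertex-faddeev-pair-sector` —
# helpers for stub `stub_fgrPositivity` (part 1/3): the variational duality of the Abel functional

Item `stmt-AtomisticToContinuum-12594` (crux `MourreDissolution` of route `EmbeddedDrudeMourre`,
sub-problem `FouriersLaw`), registered stub `stub_fgrPositivity` (S7) of the line skeleton
`Cruxes/MourreDissolution/Lines/separable_vertex_faddeev_pair_sector.lean`: a UNIFORM floor
`∃ c ν₀ > 0, ∀ ν ∈ (0, ν₀), c ≤ ∫₀^∞ e^{-νt} C_T(t) dt` of the Abel functional of the summed current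
autocorrelation of the pinned anharmonic chain. The stub itself is the lower-bound half of the
post-kinetic Green–Kubo conjecture and is NOT proved in the tree; this file provides the abstract
operator-theoretic reduction every proof of a LOWER bound on an Abel functional goes through.

Setting: a complex Hilbert space `H`, a strongly continuous one-parameter unitary group
`U : OneParameterUnitaryGroup H` with generator `A` (`U(t) = e^{tA}`, `A` skew-adjoint), `ν > 0`,
`v ∈ H`, and the Abel functional `𝒜(ν) := ∫₀^∞ e^{-νt} Re⟪v, U(t)v⟫ dt = ν‖(ν - A)⁻¹v‖²`
(`UnitaryRep.integral_exp_neg_mul_re_inner_appReal`, tree). We prove the EXACT Legendre duality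

  `𝒜(ν) = max_{φ ∈ D(A)} { 2 Re⟪v, φ⟫ - ν‖φ‖² - ν⁻¹‖Aφ‖² }`:

* `UnitaryRep.variational_le_integral_exp_neg_mul_re_inner_appReal` — the inequality `≤` for every
  `φ ∈ D(A)`: with `R = ∫₀^∞ e^{-νt}U(t)v dt` one has `v = νR - AR` (Engel–Nagel II.1.10, tree:
  `C0Semigroup.generator_laplaceResolventFun`), skew-symmetry gives `Re⟪v, φ⟫ = Re⟪R, νφ + Aφ⟫` and
  `‖νφ + Aφ‖² = ν²‖φ‖² + ‖Aφ‖²`, then Cauchy–Schwarz and AM–GM.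
* `UnitaryRep.exists_variational_eq_integral_exp_neg_mul_re_inner_appReal` — attainment at the
  symmetric Abel average `φ⋆ = ½(R₊ + R₋) = ν(ν² - A²)⁻¹v`, `R_± = ∫₀^∞ e^{-νt}U(±t)v dt`, using the
  time-reversed group `t ↦ U(-t)` (`U.restrict (ContinuousMonoidHom.inv _)`, generator `-A`:
  `UnitaryRep.generator_restrict_inv`), evenness of `Re⟪v, U(t)v⟫` and the parallelogram law.

Consequence (parts 2/3, 3/3 of these helpers): LOWER bounds on a Green–Kubo / Abel plateau are
certified by TRIAL VECTORS with no time integration, and nothing is lost in doing so.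
Sources: Engel–Nagel 2000 Ch. II Thm 1.10; Reed–Simon I Thm VIII.7; Sethuraman–Varadhan–Yau 2000 /
Komorowski–Landim–Olla 2012 Ch. 2 (variational formulas for resolvent quadratic forms). All proofs
are self-contained semigroup calculus, tagged `[folklore]`.
-/

noncomputable section

namespace Summit.AtomisticToContinuum.FouriersLaw.Theorems.MourreDissolution

open Filter Topology MeasureTheory Set
open scoped InnerProductSpace
open Literature.Analysis.UnboundedOperators

variable {H : Type*} [NormedAddCommGroup H] [InnerProductSpace ℂ H] [CompleteSpace H]

/-- AM–GM in the form used below: `2ab ≤ νa² + ν⁻¹b²` for `ν > 0`. [folklore] -/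
theorem two_mul_le_mul_sq_add_inv_mul_sq {ν : ℝ} (hν : 0 < ν) (a b : ℝ) :
    2 * a * b ≤ ν * a ^ 2 + ν⁻¹ * b ^ 2 := by
  have h : ν * a ^ 2 + ν⁻¹ * b ^ 2 - 2 * a * b = ν⁻¹ * (ν * a - b) ^ 2 := by
    field_simp
    ring
  have h2 : 0 ≤ ν⁻¹ * (ν * a - b) ^ 2 := mul_nonneg (inv_nonneg.2 hν.le) (sq_nonneg _)
  linarith

/-! ### The variational inequality -/

/-- **Variational lower bound for the Abel functional of a unitary group** (the easy half of the
Legendre duality `∫₀^∞ e^{-νt} Re⟪v, U(t)v⟫ dt = ν‖(ν - A)⁻¹v‖² = sup_φ {2Re⟪v,φ⟫ - ν‖φ‖² - ν⁻¹‖Aφ‖²}`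
for the skew-adjoint generator `A` of `U(t) = e^{tA}`): for every `φ ∈ D(A)` and `ν > 0`,
`2 Re⟪v, φ⟫ - ν‖φ‖² - ν⁻¹‖Aφ‖² ≤ ∫₀^∞ e^{-νt} Re⟪v, U(t)v⟫ dt`.
Proof: with `R = ∫₀^∞ e^{-νt}U(t)v dt` one has `v = νR - AR` (Engel–Nagel II.1.10) and the right
side is `ν‖R‖²`; by skew-symmetry `Re⟪v, φ⟫ = Re⟪R, νφ + Aφ⟫` and `‖νφ + Aφ‖² = ν²‖φ‖² + ‖Aφ‖²`,
so `2Re⟪v,φ⟫ ≤ 2‖R‖‖νφ + Aφ‖ ≤ ν‖R‖² + ν⁻¹(ν²‖φ‖² + ‖Aφ‖²)`. [folklore] -/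
theorem _root_.Literature.Analysis.UnboundedOperators.UnitaryRep.variational_le_integral_exp_neg_mul_re_inner_appReal
    (U : OneParameterUnitaryGroup H) {ν : ℝ} (hν : 0 < ν) (v : H)
    (φ : (OneParameterGroup.generator U.toStrongContRepresentation).domain) :
    2 * (⟪v, (φ : H)⟫_ℂ).re - ν * ‖(φ : H)‖ ^ 2
        - ν⁻¹ * ‖(OneParameterGroup.generator U.toStrongContRepresentation φ : H)‖ ^ 2 ≤
      ∫ t in Ioi (0 : ℝ), Real.exp (-(ν * t)) * (⟪v, U.appReal t v⟫_ℂ).re := by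
  set T := OneParameterGroup.toC0Semigroup U.toStrongContRepresentation with hT
  have hM := U.norm_toC0Semigroup_app_le
  have hl : (0 : ℝ) < ((ν : ℂ)).re := by simpa using hν
  set R : H := T.laplaceResolventFun (ν : ℂ) v with hR
  have hRdom : R ∈ (OneParameterGroup.generator U.toStrongContRepresentation).domain :=
    C0Semigroup.laplaceResolventFun_mem_generator_domain T hM hl v
  have hgen : (OneParameterGroup.generator U.toStrongContRepresentation ⟨R, hRdom⟩ : H) =
      (ν : ℂ) • R - v :=
    C0Semigroup.generator_laplaceResolventFun T hM hl v
  -- the Abel functional is `ν‖R‖²`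
  have hAbel : ∫ t in Ioi (0 : ℝ), Real.exp (-(ν * t)) * (⟪v, U.appReal t v⟫_ℂ).re = ν * ‖R‖ ^ 2 := by
    rw [U.integral_exp_neg_mul_re_inner_appReal hν v, ← U.laplaceResolventFun_toC0Semigroup_eq]
  -- `Re⟪v, φ⟫ = Re⟪R, νφ + Aφ⟫`
  set w : H := (ν : ℂ) • (φ : H) + OneParameterGroup.generator U.toStrongContRepresentation φ with hw
  have hskew : ⟪(OneParameterGroup.generator U.toStrongContRepresentation ⟨R, hRdom⟩ : H), (φ : H)⟫_ℂ =
      -⟪R, (OneParameterGroup.generator U.toStrongContRepresentation φ : H)⟫_ℂ :=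
    U.inner_generator_eq_neg ⟨R, hRdom⟩ φ
  have hv : v = (ν : ℂ) • R - OneParameterGroup.generator U.toStrongContRepresentation ⟨R, hRdom⟩ := by
    rw [hgen]; abel
  have h1 : (⟪v, (φ : H)⟫_ℂ).re = (⟪R, w⟫_ℂ).re := by
    rw [hv, inner_sub_left, inner_smul_left, hskew, hw, inner_add_right, inner_smul_right]
    simp only [Complex.conj_ofReal, Complex.sub_re, Complex.add_re, Complex.neg_re, Complex.mul_re,
      Complex.ofReal_re, Complex.ofReal_im, zero_mul, sub_zero]
    ring
  -- `‖νφ + Aφ‖² = ν²‖φ‖² + ‖Aφ‖²`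
  have hskew2 : (⟪(ν : ℂ) • (φ : H),
      (OneParameterGroup.generator U.toStrongContRepresentation φ : H)⟫_ℂ).re = 0 := by
    rw [inner_smul_left, Complex.conj_ofReal, Complex.re_ofReal_mul]
    have h := U.re_inner_generator_self φ
    have h' : (⟪(φ : H), (OneParameterGroup.generator U.toStrongContRepresentation φ : H)⟫_ℂ).re = 0 := by
      rw [← inner_conj_symm, Complex.conj_re]; exact h
    rw [h', mul_zero]
  have h2 : ‖w‖ ^ 2 = ν ^ 2 * ‖(φ : H)‖ ^ 2 +
      ‖(OneParameterGroup.generator U.toStrongContRepresentation φ : H)‖ ^ 2 := by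
    rw [hw, @norm_add_sq ℂ, RCLike.re_to_complex, hskew2, norm_smul, Complex.norm_real, Real.norm_eq_abs,
      abs_of_pos hν]
    ring
  -- Cauchy–Schwarz and AM–GM
  have h3 : (⟪R, w⟫_ℂ).re ≤ ‖R‖ * ‖w‖ := by
    have h := re_inner_le_norm (𝕜 := ℂ) R w
    rwa [RCLike.re_to_complex] at h
  have h4 : 2 * ‖R‖ * ‖w‖ ≤ ν * ‖R‖ ^ 2 + ν⁻¹ * ‖w‖ ^ 2 := two_mul_le_mul_sq_add_inv_mul_sq hν _ _
  rw [hAbel, h1]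
  have h5 : ν⁻¹ * ‖w‖ ^ 2 = ν * ‖(φ : H)‖ ^ 2 +
      ν⁻¹ * ‖(OneParameterGroup.generator U.toStrongContRepresentation φ : H)‖ ^ 2 := by
    rw [h2]; field_simp
  nlinarith [h3, h4, h5, norm_nonneg R, norm_nonneg w]

/-! ### Attainment: the bound is an equality at the symmetric Abel average -/

/-- The time-reversed group `U.restrict (ContinuousMonoidHom.inv _)` (restriction along the
inversion of `Multiplicative ℝ`) acts by `t ↦ U(-t)`. [folklore] -/
@[simp] theorem _root_.Literature.Analysis.UnboundedOperators.UnitaryRep.restrict_inv_appReal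
    (U : OneParameterUnitaryGroup H) (t : ℝ) :
    (U.restrict (ContinuousMonoidHom.inv (Multiplicative ℝ))).appReal t = U.appReal (-t) := rfl

/-- **The generator of the time-reversed group `t ↦ U(-t)` is `-A` on its domain** (which is
contained in, in fact equal to, `D(A)`): two-sided differentiability of `t ↦ U(-t)x` at `0` is
two-sided differentiability of `t ↦ U(t)x` (Engel–Nagel II.3.11). [folklore] -/
theorem _root_.Literature.Analysis.UnboundedOperators.UnitaryRep.generator_restrict_inv
    (U : OneParameterUnitaryGroup H)
    (x : (OneParameterGroup.generator
      (U.restrict (ContinuousMonoidHom.inv (Multiplicative ℝ))).toStrongContRepresentation).domain) :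
    ∃ hx : (x : H) ∈ (OneParameterGroup.generator U.toStrongContRepresentation).domain,
      OneParameterGroup.generator U.toStrongContRepresentation ⟨x, hx⟩ =
        -OneParameterGroup.generator
          (U.restrict (ContinuousMonoidHom.inv (Multiplicative ℝ))).toStrongContRepresentation x := by
  set y : H := OneParameterGroup.generator
    (U.restrict (ContinuousMonoidHom.inv (Multiplicative ℝ))).toStrongContRepresentation x with hy
  have ht := OneParameterGroup.tendsto_generator_two_sided_holds
    (U.restrict (ContinuousMonoidHom.inv (Multiplicative ℝ))).toStrongContRepresentation x
  have hd : HasDerivAt (fun t : ℝ => U.appReal (-t) (x : H)) y 0 := by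
    have ht' : Tendsto (fun t : ℝ => t⁻¹ • (OneParameterGroup.app
        (U.restrict (ContinuousMonoidHom.inv (Multiplicative ℝ))).toStrongContRepresentation t
          (x : H) - x)) (𝓝[≠] 0) (𝓝 y) := by
      simpa only [RCLike.real_smul_eq_coe_smul (K := ℂ)] using ht
    rw [hasDerivAt_iff_tendsto_slope_zero]
    simpa only [zero_add, neg_zero, UnitaryRep.appReal_zero, one_apply_eq_self,
      UnitaryRep.app_toStrongContRepresentation, UnitaryRep.restrict_inv_appReal] using ht'
  have hd' : HasDerivAt (fun t : ℝ => U.appReal (-t) (x : H)) y (-(0 : ℝ)) := by rwa [neg_zero]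
  have hd2 : HasDerivAt (fun t : ℝ => OneParameterGroup.app U.toStrongContRepresentation t (x : H))
      (-y) 0 := by
    have h := hd'.scomp (0 : ℝ) (hasDerivAt_neg (0 : ℝ))
    have e : ((fun t : ℝ => U.appReal (-t) (x : H)) ∘ Neg.neg) =
        fun t : ℝ => OneParameterGroup.app U.toStrongContRepresentation t (x : H) := by
      funext t
      simp only [Function.comp_apply, neg_neg, UnitaryRep.app_toStrongContRepresentation]
    rw [e, neg_one_smul] at h
    exact h
  exact OneParameterGroup.mem_generator_domain_of_hasDerivAt U.toStrongContRepresentation hd2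

/-- `Re⟪v, U(t)v⟫` is even in `t`: `Re⟪v, U(-t)v⟫ = Re⟪v, U(t)v⟫`. [folklore] -/
theorem _root_.Literature.Analysis.UnboundedOperators.UnitaryRep.re_inner_appReal_neg
    (U : OneParameterUnitaryGroup H) (t : ℝ) (v : H) :
    (⟪v, U.appReal (-t) v⟫_ℂ).re = (⟪v, U.appReal t v⟫_ℂ).re := by
  rw [← U.inner_appReal_left, ← inner_conj_symm, Complex.conj_re]

/-- For `R = ∫₀^∞ e^{-νt}U(t)v dt` one has `Re⟪v, R⟫ = ν‖R‖²` (`v = νR - AR` and `Re⟪AR, R⟫ = 0`).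
[folklore] -/
theorem _root_.Literature.Analysis.UnboundedOperators.UnitaryRep.re_inner_laplaceResolventFun
    (U : OneParameterUnitaryGroup H) {ν : ℝ} (hν : 0 < ν) (v : H) :
    (⟪v, (OneParameterGroup.toC0Semigroup U.toStrongContRepresentation).laplaceResolventFun
        (ν : ℂ) v⟫_ℂ).re =
      ν * ‖(OneParameterGroup.toC0Semigroup U.toStrongContRepresentation).laplaceResolventFun
        (ν : ℂ) v‖ ^ 2 := by
  set T := OneParameterGroup.toC0Semigroup U.toStrongContRepresentation with hT
  have hM := U.norm_toC0Semigroup_app_le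
  have hl : (0 : ℝ) < ((ν : ℂ)).re := by simpa using hν
  set R : H := T.laplaceResolventFun (ν : ℂ) v with hR
  have hRdom : R ∈ (OneParameterGroup.generator U.toStrongContRepresentation).domain :=
    C0Semigroup.laplaceResolventFun_mem_generator_domain T hM hl v
  have hgen : (OneParameterGroup.generator U.toStrongContRepresentation ⟨R, hRdom⟩ : H) =
      (ν : ℂ) • R - v :=
    C0Semigroup.generator_laplaceResolventFun T hM hl v
  have hv : v = (ν : ℂ) • R - OneParameterGroup.generator U.toStrongContRepresentation ⟨R, hRdom⟩ := by
    rw [hgen]; abel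
  have hskew := U.re_inner_generator_self ⟨R, hRdom⟩
  conv_lhs => rw [hv]
  rw [inner_sub_left, inner_smul_left, Complex.conj_ofReal, Complex.sub_re, Complex.re_ofReal_mul,
    inner_self_eq_norm_sq_to_K, hskew, sub_zero]
  norm_cast

/-- **The variational bound is attained** (so it is an identity:
`∫₀^∞ e^{-νt} Re⟪v, U(t)v⟫ dt = max_{φ ∈ D(A)} {2Re⟪v,φ⟫ - ν‖φ‖² - ν⁻¹‖Aφ‖²}`): the maximiser is the
symmetric Abel average `φ⋆ = ½(R₊ + R₋) = ½∫_ℝ e^{-ν|t|} U(t)v dt = ν(ν² - A²)⁻¹v`, where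
`R_± = ∫₀^∞ e^{-νt}U(±t)v dt`, `AR_± = ±(νR_± - v)`, `Aφ⋆ = (ν/2)(R₊ - R₋)`, and
`‖R₊‖ = ‖R₋‖` by evenness of `Re⟪v, U(t)v⟫`; the value is `(ν/2)(‖R₊‖² + ‖R₋‖²) = ν‖R₊‖²` by the
parallelogram law. [folklore] -/
theorem _root_.Literature.Analysis.UnboundedOperators.UnitaryRep.exists_variational_eq_integral_exp_neg_mul_re_inner_appReal
    (U : OneParameterUnitaryGroup H) {ν : ℝ} (hν : 0 < ν) (v : H) :
    ∃ φ : (OneParameterGroup.generator U.toStrongContRepresentation).domain,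
      2 * (⟪v, (φ : H)⟫_ℂ).re - ν * ‖(φ : H)‖ ^ 2
          - ν⁻¹ * ‖(OneParameterGroup.generator U.toStrongContRepresentation φ : H)‖ ^ 2 =
        ∫ t in Ioi (0 : ℝ), Real.exp (-(ν * t)) * (⟪v, U.appReal t v⟫_ℂ).re := by
  have hl : (0 : ℝ) < ((ν : ℂ)).re := by simpa using hν
  -- the forward resolvent `R₊`
  set T := OneParameterGroup.toC0Semigroup U.toStrongContRepresentation with hT
  have hM := U.norm_toC0Semigroup_app_le
  set Rp : H := T.laplaceResolventFun (ν : ℂ) v with hRp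
  have hRp_dom : Rp ∈ (OneParameterGroup.generator U.toStrongContRepresentation).domain :=
    C0Semigroup.laplaceResolventFun_mem_generator_domain T hM hl v
  have hRp_gen : (OneParameterGroup.generator U.toStrongContRepresentation ⟨Rp, hRp_dom⟩ : H) =
      (ν : ℂ) • Rp - v :=
    C0Semigroup.generator_laplaceResolventFun T hM hl v
  have hRp_re : (⟪v, Rp⟫_ℂ).re = ν * ‖Rp‖ ^ 2 := U.re_inner_laplaceResolventFun hν v
  -- the backward resolvent `R₋` (Laplace transform of the time-reversed group)
  set Ur := U.restrict (ContinuousMonoidHom.inv (Multiplicative ℝ)) with hUr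
  set Tm := OneParameterGroup.toC0Semigroup Ur.toStrongContRepresentation with hTm
  have hMm := Ur.norm_toC0Semigroup_app_le
  set Rm : H := Tm.laplaceResolventFun (ν : ℂ) v with hRm
  have hRm_dom' : Rm ∈ (OneParameterGroup.generator Ur.toStrongContRepresentation).domain :=
    C0Semigroup.laplaceResolventFun_mem_generator_domain Tm hMm hl v
  have hRm_gen' : (OneParameterGroup.generator Ur.toStrongContRepresentation ⟨Rm, hRm_dom'⟩ : H) =
      (ν : ℂ) • Rm - v :=
    C0Semigroup.generator_laplaceResolventFun Tm hMm hl v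
  have hRm_re : (⟪v, Rm⟫_ℂ).re = ν * ‖Rm‖ ^ 2 := Ur.re_inner_laplaceResolventFun hν v
  obtain ⟨hRm_dom, hRm_gen⟩ := U.generator_restrict_inv ⟨Rm, hRm_dom'⟩
  rw [hRm_gen'] at hRm_gen
  -- `‖R₋‖ = ‖R₊‖`
  have hAp : ∫ t in Ioi (0 : ℝ), Real.exp (-(ν * t)) * (⟪v, U.appReal t v⟫_ℂ).re = ν * ‖Rp‖ ^ 2 := by
    rw [U.integral_exp_neg_mul_re_inner_appReal hν v, ← U.laplaceResolventFun_toC0Semigroup_eq]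
  have hAm : ∫ t in Ioi (0 : ℝ), Real.exp (-(ν * t)) * (⟪v, U.appReal t v⟫_ℂ).re = ν * ‖Rm‖ ^ 2 := by
    rw [hRm, hTm, Ur.laplaceResolventFun_toC0Semigroup_eq,
      ← Ur.integral_exp_neg_mul_re_inner_appReal hν v]
    refine integral_congr_ae (ae_of_all _ fun t => ?_)
    simp only [hUr, UnitaryRep.restrict_inv_appReal, U.re_inner_appReal_neg]
  have hnorm : ‖Rm‖ ^ 2 = ‖Rp‖ ^ 2 := by
    have h := hAm.symm.trans hAp
    exact mul_left_cancel₀ hν.ne' h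
  -- the maximiser `φ⋆ = ½(R₊ + R₋)`
  have hsum_dom : Rp + Rm ∈ (OneParameterGroup.generator U.toStrongContRepresentation).domain :=
    Submodule.add_mem _ hRp_dom hRm_dom
  refine ⟨(2⁻¹ : ℂ) • ⟨Rp + Rm, hsum_dom⟩, ?_⟩
  have hAsum : (OneParameterGroup.generator U.toStrongContRepresentation ⟨Rp + Rm, hsum_dom⟩ : H) =
      (ν : ℂ) • (Rp - Rm) := by
    have e : (⟨Rp + Rm, hsum_dom⟩ :
        (OneParameterGroup.generator U.toStrongContRepresentation).domain) =
        ⟨Rp, hRp_dom⟩ + ⟨Rm, hRm_dom⟩ := rfl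
    rw [e, LinearPMap.map_add, hRp_gen, hRm_gen, smul_sub]
    abel
  have hAφ : (OneParameterGroup.generator U.toStrongContRepresentation
      ((2⁻¹ : ℂ) • ⟨Rp + Rm, hsum_dom⟩) : H) = ((ν / 2 : ℝ) : ℂ) • (Rp - Rm) := by
    rw [LinearPMap.map_smul, hAsum, smul_smul]
    congr 1
    push_cast
    ring
  have hcoe : (((2⁻¹ : ℂ) • ⟨Rp + Rm, hsum_dom⟩ :
      (OneParameterGroup.generator U.toStrongContRepresentation).domain) : H) =
      ((2⁻¹ : ℝ) : ℂ) • (Rp + Rm) := by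
    push_cast
    rfl
  rw [hAφ, hcoe, inner_smul_right, norm_smul, norm_smul, Complex.norm_real, Complex.norm_real,
    Real.norm_eq_abs, Real.norm_eq_abs, abs_of_pos (by norm_num : (0 : ℝ) < 2⁻¹),
    abs_of_pos (by positivity : (0 : ℝ) < ν / 2), Complex.re_ofReal_mul, inner_add_right,
    Complex.add_re, hRp_re, hRm_re, hAp]
  have hpar := parallelogram_law_with_norm ℂ Rp Rm
  rw [mul_pow, mul_pow, hnorm]
  have hp' : ‖Rp + Rm‖ ^ 2 + ‖Rp - Rm‖ ^ 2 = 4 * ‖Rp‖ ^ 2 := by nlinarith [hpar, hnorm]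
  field_simp
  nlinarith [hp', hnorm]

/-- **The exact duality, supremum form**: for `ν > 0` the Abel functional is the maximum of the
concave functional `φ ↦ 2Re⟪v,φ⟫ - ν‖φ‖² - ν⁻¹‖Aφ‖²` over `D(A)` — an upper bound `c` of all
trial values is an upper bound of `𝒜(ν)` and conversely. [folklore] -/
theorem _root_.Literature.Analysis.UnboundedOperators.UnitaryRep.le_integral_exp_neg_mul_re_inner_appReal_iff
    (U : OneParameterUnitaryGroup H) {ν : ℝ} (hν : 0 < ν) (v : H) (c : ℝ) :
    c ≤ ∫ t in Ioi (0 : ℝ), Real.exp (-(ν * t)) * (⟪v, U.appReal t v⟫_ℂ).re ↔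
      ∃ φ : (OneParameterGroup.generator U.toStrongContRepresentation).domain,
        c ≤ 2 * (⟪v, (φ : H)⟫_ℂ).re - ν * ‖(φ : H)‖ ^ 2
          - ν⁻¹ * ‖(OneParameterGroup.generator U.toStrongContRepresentation φ : H)‖ ^ 2 := by
  constructor
  · intro hc
    obtain ⟨φ, hφ⟩ := U.exists_variational_eq_integral_exp_neg_mul_re_inner_appReal hν v
    exact ⟨φ, hφ ▸ hc⟩
  · rintro ⟨φ, hφ⟩
    exact hφ.trans (U.variational_le_integral_exp_neg_mul_re_inner_appReal hν v φ)

/-- **Headline of this file (registered helper stub of `stmt-AtomisticToContinuum-12594`): the exact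
variational duality of the Abel functional of a one-parameter unitary group**, supremum form —
for `ν > 0`, `v ∈ K` and `c ∈ ℝ`:
`c ≤ ∫₀^∞ e^{-νt} Re⟪v, U(t)v⟫ dt ↔ ∃ φ ∈ D(A), c ≤ 2Re⟪v,φ⟫ - ν‖φ‖² - ν⁻¹‖Aφ‖²`
(`A` the generator of `U`). [folklore] -/
theorem abelFunctional_variational_duality :
    ∀ (K : Type) [NormedAddCommGroup K] [InnerProductSpace ℂ K] [CompleteSpace K]
      (U : Literature.Analysis.UnboundedOperators.OneParameterUnitaryGroup K) (ν : ℝ), 0 < ν →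
      ∀ (v : K) (c : ℝ),
        c ≤ MeasureTheory.integral (MeasureTheory.volume.restrict (Set.Ioi (0:ℝ)))
            (fun t : ℝ => Real.exp (-(ν * t)) * (⟪v, U.appReal t v⟫_ℂ).re) ↔
          ∃ φ : (Literature.Analysis.UnboundedOperators.OneParameterGroup.generator
              U.toStrongContRepresentation).domain,
            c ≤ 2 * (⟪v, (φ : K)⟫_ℂ).re - ν * ‖(φ : K)‖ ^ 2 -
              ν⁻¹ * ‖(Literature.Analysis.UnboundedOperators.OneParameterGroup.generator
                U.toStrongContRepresentation φ : K)‖ ^ 2 := by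
  intro K _ _ _ U ν hν v c
  exact U.le_integral_exp_neg_mul_re_inner_appReal_iff hν v c

end Summit.AtomisticToContinuum.FouriersLaw.Theorems.MourreDissolution

end
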